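import Summits.NavierStokesRegularity.NavierStokesRegularity.Theorems.OddMorawetzLocal.Negative.OddMorawetzLocalRefutationDefsVI
import Summits.NavierStokesRegularity.NavierStokesRegularity.Theorems.OddMorawetzOddMorawetzLocalCertBridge
import Summits.NavierStokesRegularity.NavierStokesRegularity.Theorems.OddMorawetzOddMorawetzLocalNormFSemantics
import HarnessLib

/-!
# Row-chunked certificate checks as matrix identities mod `p` (crux `OddMorawetzLocal`, refutation)

Stubs `certB_mul_eq_one_of_rows` and `isoCert_mul_eq_one_of_rows` of the refutation skeleton of the crux
`Summit.NavierStokesRegularity.NavierStokesRegularity.Theses.OddMorawetz.OddMorawetzLocal`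
(item `stmt-NavierStokesRegularity-1376`). Pure list/index bookkeeping over Mathlib; no named facts, no definitions.

At weight 5 the one-shot kernel checks `blockCheck` (one block of the rank certificate of the derivation matrix
`aMatrix k reps`) and `isoCertCheck` (the independence certificate of the isotropic basis in orbit coordinates) do not
fit in a single `decide`; the kernel certifies instead their row-chunked twins `blockCheckRows … lo n` and
`isoCertCheckRows … lo n` (vocabulary VI) on ranges of rows `[lo, lo + n)` which together cover every row. We show
that such a cover implies the one-shot Booleans themselves, and then apply the landed one-shot bridges
`certB_mul_eq_one` (`…OddMorawetzLocalCertBridge`) and `isoCert_mul_eq_one` (`…OddMorawetzLocalIsoCert`) verbatim —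
these are hypotheses `hB` and `hC` of the landed `kernel_eq_span_of_modular_certificate`.

* `CertBridgeRows.minorColsF_eq` — the `normF`-normalised minor columns `minorColsF` ARE the minor columns
  `minorCols`: the monomials of a `derP` output are `sortVars`-values (`sortVars_of_mem_derP`, as in
  `IsoTransfer.kernel_checks`), so the landed `JPoly.coeffOf_normF` (`…OddMorawetzLocalNormFSemantics`) applies;
* `CertBridgeRows.blockCheck_of_rows` — the rows `[lo, lo + n)` tested by `blockCheckRows` are literally the rows of
  the list-matrix product `matMulMod rows invCols p` tested by `isIdentityList` in `blockCheck` (`List.all_eq_true`,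
  `List.mem_range'_1`, `List.getD_eq_getElem`, `List.getElem_map`);
* `CertBridgeRows.isoCertCheck_of_rows` — likewise for `isoCertCheckRows` / `isoCertCheck`;
* the sizes needed to read the entries in range (`inv` square of the block size, `cinv.length = d`) are part of the
  checked ranges `certRangesOk`.
-/

set_option linter.dupNamespace false
set_option autoImplicit false

namespace Summit.NavierStokesRegularity.NavierStokesRegularity.Theorems.OddMorawetz

namespace CertBridgeRows

/-! ### The normalised minor columns -/

/-- The monomials of a `derP` output are sorted (`derP` emits `sortVars`-values). -/
theorem sortVars_of_mem_derP (L : Matrix (Fin 3) (Fin 3) ℤ) (q : JPoly ℤ) :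
    ∀ t ∈ JPoly.derP L q, sortVars t.2 = t.2 := by
  -- adapted from `IsoTransfer.kernel_checks` (…OddMorawetzLocalIsoTransfer.lean)
  intro t ht
  unfold JPoly.derP at ht
  obtain ⟨u, -, hu⟩ := List.mem_flatMap.1 ht
  obtain ⟨s, -, hs⟩ := List.mem_flatMap.1 hu
  obtain ⟨cw, -, rfl⟩ := List.mem_map.1 hs
  exact sortVars_sortVars _

/-- Normalising a derivation column with `normF` does not change its coefficients. -/
theorem coeffOf_normF_derP (L : Matrix (Fin 3) (Fin 3) ℤ) (q : JPoly ℤ) (m : List JVar) :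
    JPoly.coeffOf (JPoly.normF (JPoly.derP L q)) m = JPoly.coeffOf (JPoly.derP L q) m :=
  JPoly.coeffOf_normF _ (sortVars_of_mem_derP L q) m

/-- The `normF`-normalised minor columns are the minor columns. -/
theorem minorColsF_eq (k : ℕ) (L : Matrix (Fin 3) (Fin 3) ℤ) (reps : List (List JVar)) (rs cs : List ℕ) (p : ℕ) :
    minorColsF k L reps rs cs p = minorCols k L reps rs cs p := by
  simp only [minorColsF, minorCols, coeffOf_normF_derP]

/-! ### Row covers imply the one-shot checks -/

/-- **Rows ⇒ block check.** If every row `a < rs.length` of a block lies in a row range accepted by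
`blockCheckRows`, then the one-shot check `blockCheck` of that block holds (`inv` square of size `rs.length`). -/
theorem blockCheck_of_rows (k p : ℕ) (L : Matrix (Fin 3) (Fin 3) ℤ) (reps : List (List JVar)) (rs cs : List ℕ)
    (inv : List (List ℕ)) (hinv : inv.length = rs.length)
    (h : ∀ a, a < rs.length → ∃ lo n, lo ≤ a ∧ a < lo + n ∧ blockCheckRows k L reps rs cs inv p lo n = true) :
    blockCheck k L reps rs cs inv p = true := by
  set rows : List (List ℕ) := colsToRows (minorCols k L reps rs cs p) rs.length with hrows
  set invCols : List (List ℕ) := colsToRows inv inv.length with hinvCols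
  show isIdentityList (matMulMod rows invCols p) = true
  have hRl : rows.length = rs.length := by simp [hrows, colsToRows]
  have hCl : invCols.length = rs.length := by simp [hinvCols, colsToRows, hinv]
  have hlen : (matMulMod rows invCols p).length = rs.length := by simp [matMulMod, hRl]
  unfold isIdentityList
  simp only [List.all_eq_true, List.mem_range, decide_eq_true_eq, hlen]
  intro i hi j hj
  obtain ⟨lo, n, h1, h2, h3⟩ := h i hi
  -- row `i` of the chunk containing it
  have h4 : (List.zipWith (· * ·) (rows.getD i []) (invCols.getD j [])).foldr (fun x acc => (x + acc) % p) 0 =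
      if i = j then 1 else 0 := by
    unfold blockCheckRows at h3
    simp only [List.all_eq_true, List.mem_range'_1, List.mem_range, decide_eq_true_eq, minorColsF_eq] at h3
    exact h3 i ⟨h1, h2⟩ j hj
  rw [← h4, List.getD_eq_getElem _ [] (by rw [hlen]; exact hi)]
  simp only [matMulMod, List.getElem_map]
  rw [List.getD_eq_getElem _ (0 : ℕ) (by rw [List.length_map, hCl]; exact hj), List.getElem_map,
    List.getD_eq_getElem rows [] (by rw [hRl]; exact hi), List.getD_eq_getElem invCols [] (by rw [hCl]; exact hj)]

/-- **Rows ⇒ independence check.** If every row `l < d` lies in a row range accepted by `isoCertCheckRows`, then the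
one-shot check `isoCertCheck` holds (`iso.length = cinv.length = d`). -/
theorem isoCertCheck_of_rows (reps : List (List JVar)) (iso : List IsoDesc) (kcols : List ℕ) (cinv : List (List ℕ))
    (p d : ℕ) (hd : iso.length = d) (hcl : cinv.length = d)
    (h : ∀ l, l < d → ∃ lo n, lo ≤ l ∧ l < lo + n ∧ isoCertCheckRows reps iso kcols cinv p lo n = true) :
    isoCertCheck reps iso kcols cinv p = true := by
  -- adapted from `isoCert_mul_eq_one` (…OddMorawetzLocalIsoCert.lean): the rows of the check
  set M : List (List ℕ) := iso.map fun q =>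
    kcols.map fun c => Int.toNat ((JPoly.coeffOf (isoPolyF q) (reps.getD c [])) % (p : ℤ)) with hM
  set cinvCols : List (List ℕ) := colsToRows cinv cinv.length with hcinvCols
  show isIdentityList (matMulMod M cinvCols p) = true
  have hMl : M.length = d := by simp [hM, hd]
  have hCl : cinvCols.length = d := by simp [hcinvCols, colsToRows, hcl]
  have hlen : (matMulMod M cinvCols p).length = d := by simp [matMulMod, hMl]
  unfold isIdentityList
  simp only [List.all_eq_true, List.mem_range, decide_eq_true_eq, hlen]
  intro l hl l' hl'
  obtain ⟨lo, n, h1, h2, h3⟩ := h l hl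
  -- row `l` of the chunk containing it
  have hMi : M.getD l [] = kcols.map fun c =>
      Int.toNat ((JPoly.coeffOf (isoPolyF (iso.getD l (.poly []))) (reps.getD c [])) % (p : ℤ)) := by
    rw [List.getD_eq_getElem M [] (by omega), List.getD_eq_getElem iso (.poly []) (by omega)]
    simp [hM]
  have h4 : (List.zipWith (· * ·) (M.getD l []) (cinvCols.getD l' [])).foldr (fun x acc => (x + acc) % p) 0 =
      if l = l' then 1 else 0 := by
    unfold isoCertCheckRows at h3
    simp only [List.all_eq_true, List.mem_range'_1, List.mem_range, decide_eq_true_eq] at h3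
    rw [hMi]
    exact h3 l ⟨h1, h2⟩ l' (by omega)
  rw [← h4, List.getD_eq_getElem _ [] (by rw [hlen]; exact hl)]
  simp only [matMulMod, List.getElem_map]
  rw [List.getD_eq_getElem _ (0 : ℕ) (by rw [List.length_map, hCl]; exact hl'), List.getElem_map,
    List.getD_eq_getElem M [] (by omega), List.getD_eq_getElem cinvCols [] (by omega)]

end CertBridgeRows

open CertBridgeRows

/-- **Stub `certB_mul_eq_one_of_rows` of crux `OddMorawetzLocal` (refutation).** If every row of every block
certificate lies in a row range accepted by `blockCheckRows`, the blocks are shape-disjoint (`blockShapesDisjoint`),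
the derivation columns are shape-pure (`colShapePure`) and the ranges are as checked by `certRangesOk`, then the
`r × r` minor of the derivation matrix `aMatrix k reps` on the concatenated certificate rows/columns, reduced mod `p`,
has the block-diagonal right inverse `certBd blocks p r` (the landed `certB_mul_eq_one`, fed by
`CertBridgeRows.blockCheck_of_rows`). -/
theorem certB_mul_eq_one_of_rows (k : ℕ) (reps : List (List JVar)) (blocks : List (List ℕ × List ℕ × List (List ℕ)))
    (kcols : List ℕ) (cinv : List (List ℕ)) (d p r : ℕ) [Fact p.Prime]
    (hblk : ∀ β, β < blocks.length → ∀ a, a < (blocks.getD β ([], [], [])).1.length →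
      ∃ lo n, lo ≤ a ∧ a < lo + n ∧
        blockCheckRows k lieZ reps (blocks.getD β ([], [], [])).1 (blocks.getD β ([], [], [])).2.1
          (blocks.getD β ([], [], [])).2.2 p lo n = true)
    (hdisj : blockShapesDisjoint k reps blocks = true)
    (hpure : colShapePure reps (certCols blocks) = true)
    (hrng : certRangesOk k reps blocks kcols cinv d = true)
    (hr : (certRows blocks).length = r)
    (hI : 0 < (idx k).length) (hJ : 0 < reps.length) :
    (((aMatrix k reps).submatrix (certIdx (certRows blocks) (idx k).length r hI)
        (certIdx (certCols blocks) reps.length r hJ)).map (Int.cast : ℤ → ZMod p)) * certBd blocks p r = 1 := by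
  -- the checked ranges: every inverse block is square of the block size
  have hsq : ∀ b ∈ blocks, b.2.2.length = b.1.length := by
    have h := hrng
    unfold certRangesOk at h
    simp only [Bool.and_eq_true, List.all_eq_true, decide_eq_true_eq] at h
    obtain ⟨⟨⟨⟨hblocks, -⟩, -⟩, -⟩, -⟩ := h
    exact fun b hb => (hblocks b hb).1.2
  refine certB_mul_eq_one k reps blocks kcols cinv d p r (fun β hβ => ?_) hdisj hpure hrng hr hI hJ
  have hb : blocks.getD β ([], [], []) ∈ blocks := by
    rw [List.getD_eq_getElem _ _ hβ]
    exact List.getElem_mem _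
  exact blockCheck_of_rows k p lieZ reps _ _ _ (hsq _ hb) (hblk β hβ)

/-- **Stub `isoCert_mul_eq_one_of_rows` of crux `OddMorawetzLocal` (refutation).** If every row `l < d` of the
independence certificate lies in a row range accepted by `isoCertCheckRows` and the index ranges are as checked by
`certRangesOk`, then the `d × d` coordinate minor (columns `kcols`) of the isotropic basis in orbit coordinates,
reduced mod `p`, has the right inverse `certCd cinv p d` (the landed `isoCert_mul_eq_one`, fed by
`CertBridgeRows.isoCertCheck_of_rows`). -/
theorem isoCert_mul_eq_one_of_rows (k : ℕ) (reps : List (List JVar)) (blocks : List (List ℕ × List ℕ × List (List ℕ)))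
    (iso : List IsoDesc) (kcols : List ℕ) (cinv : List (List ℕ)) (d p : ℕ) [Fact p.Prime]
    (hcert : ∀ l, l < d → ∃ lo n, lo ≤ l ∧ l < lo + n ∧ isoCertCheckRows reps iso kcols cinv p lo n = true)
    (hrng : certRangesOk k reps blocks kcols cinv d = true) (hd : iso.length = d) (hJ : 0 < reps.length) :
    (Matrix.of fun l l' : Fin d =>
        ((sVecD reps iso d l (certIdx kcols reps.length d hJ l') : ℤ) : ZMod p)) * certCd cinv p d = 1 := by
  -- the checked ranges: `cinv` has `d` rows
  have hcl : cinv.length = d := by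
    have h := hrng
    unfold certRangesOk at h
    simp only [Bool.and_eq_true, List.all_eq_true, decide_eq_true_eq] at h
    obtain ⟨⟨⟨⟨-, -⟩, -⟩, hcl⟩, -⟩ := h
    exact hcl
  exact isoCert_mul_eq_one k reps blocks iso kcols cinv d p (isoCertCheck_of_rows reps iso kcols cinv p d hd hcl hcert)
    hrng hd hJ

end Summit.NavierStokesRegularity.NavierStokesRegularity.Theorems.OddMorawetz
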